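import Summits.HubbardSuperconductivity.HubbardSuperconductivity.Theorems.AnisotropyChordTransferFibre3RowDNTerm
import Summits.HubbardSuperconductivity.HubbardSuperconductivity.Theorems.AnisotropyChordTransferFibre3RowDFourier
import Summits.HubbardSuperconductivity.HubbardSuperconductivity.Theorems.AnisotropyChordTransferFibre3RowDConvolution

/-!
# Route `AnisotropyChord` / H0 rotor rung, row D (KT-2a) Stage-1 evaluator: TWO-SLOT spec convolutions (the `D`-boundary's `Z(F,G)`)

Layer F1 of the row-D program (p1 g29 memo ROWD-DESIGN-g29 §6).  The `D`-boundary sums of `OffDTransform` are, by g27's `BoundaryLines`,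
combinations of pair transforms `Z(F,G)(q) = FT[F·G](q) = (1/V) Σ_p F̂(p) Ĝ(q − p)` (`PairConvolution`) of slot profiles, their gradients
`D_e`, and their shifts `F(· ∓ e)`.  All of these have uniform-spec transforms: ★ `dft_slotD` (`D_e slot ↦ psiU kind 1 (−1) e`),
★ `dft_slot_shift_sub` / ★ `dft_slot_shift_add` (`slot(· − e) ↦ psiU kind 0 1 e`, `slot(· + e) ↦ psiU kind 0 1 (−e)`; `ShiftTransform`).
The generic two-slot `δ`-split ★ `pair_numerator_split : Σ_p F_ψ₁(p) F_ψ₂(q−p) = V·closed2U ψ₁ ψ₂ q + Σ_p R_ψ₁(p) R_ψ₂(q−p)` (cf. the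
three-slot `tconv_numerator_split`), hence ★ `pairZ_split : Z(F,G)(q) = closed2U + loop2U` whenever `F̂ = F_ψ₁`, `Ĝ = F_ψ₂`.
(The `RExpr` evaluation of `closed2U/V` by weight pattern and the boundary assembly `bTermE` are layer F2.)
Prover seat `hubbard-h0-rotor-p1` g29 (route lead); helper for piece A = stmt-HubbardSuperconductivity-23918 of rung 19089
(`--supports`, helper class).  Nothing here proves superconductivity in the Hubbard model; lemmas for ONE row of ONE conditional reduction;
the rotor TARGET as originally worded stays FALSE (g15 verdict).  Tree imports only; no sorry.
-/

set_option linter.dupNamespace false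
set_option autoImplicit false

open Literature.Analysis.ValidatedNumerics

namespace Summit.HubbardSuperconductivity.HubbardSuperconductivity.Theorems.AnisotropyChord.Transfer.Fibre3

namespace RowD

open RowC L2.N1

variable (L : ℕ) [NeZero L]

/-! ## The generic two-slot `δ`-split -/

/-- the closed part of `(1/V) Σ_p F_ψ₁(p) F_ψ₂(q − p)`: `α₁α₂ V W₁W₂ [q = 0] + α₁ W₁ R_ψ₂(q) + α₂ W₂ R_ψ₁(q)`, `W_i = u_i + u′_i`. -/
noncomputable def closed2U (lam2 : ℝ) (ψ₁ ψ₂ : Tor L × ℝ × ℝ × ℝ × ℝ × ℝ) (q : Tor L) : ℂ :=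
  let V : ℂ := (L : ℂ) ^ 2
  let α₁ : ℂ := ((ψ₁.2.2.2.1 : ℝ) : ℂ); let α₂ : ℂ := ((ψ₂.2.2.2.1 : ℝ) : ℂ)
  let W₁ : ℂ := ((ψ₁.2.1 + ψ₁.2.2.1 : ℝ) : ℂ); let W₂ : ℂ := ((ψ₂.2.1 + ψ₂.2.2.1 : ℝ) : ℂ)
  α₁ * α₂ * V * (if q = 0 then 1 else 0) * W₁ * W₂ + α₁ * W₁ * RfacU L lam2 ψ₂ q + α₂ * W₂ * RfacU L lam2 ψ₁ q

/-- the loop part: `(1/V) Σ_p R_ψ₁(p) R_ψ₂(q − p)` (a two-propagator primitive; majorised in Stage-1b). -/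
noncomputable def loop2U (lam2 : ℝ) (ψ₁ ψ₂ : Tor L × ℝ × ℝ × ℝ × ℝ × ℝ) (q : Tor L) : ℂ :=
  (∑ p : Tor L, RfacU L lam2 ψ₁ p * RfacU L lam2 ψ₂ (q - p)) / (L : ℂ) ^ 2

/-- ★ collapsing the two `δ`'s: `Σ_p F_ψ₁(p) F_ψ₂(q − p) = V·closed2U + Σ_p R_ψ₁(p) R_ψ₂(q − p)`. [folklore] -/
theorem pair_numerator_split (lam2 : ℝ) (ψ₁ ψ₂ : Tor L × ℝ × ℝ × ℝ × ℝ × ℝ) (q : Tor L) :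
    (∑ p : Tor L, FfacU L lam2 ψ₁ p * FfacU L lam2 ψ₂ (q - p))
      = (L : ℂ) ^ 2 * closed2U L lam2 ψ₁ ψ₂ q + ∑ p : Tor L, RfacU L lam2 ψ₁ p * RfacU L lam2 ψ₂ (q - p) := by
  set c₁ : ℂ := ((ψ₁.2.2.2.1 : ℝ) : ℂ) * (L : ℂ) ^ 2 * ((ψ₁.2.1 + ψ₁.2.2.1 : ℝ) : ℂ) with hc₁
  set c₂ : ℂ := ((ψ₂.2.2.2.1 : ℝ) : ℂ) * (L : ℂ) ^ 2 * ((ψ₂.2.1 + ψ₂.2.2.1 : ℝ) : ℂ) with hc₂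
  set F₂ := FfacU L lam2 ψ₂ with hF₂
  set R₁ := RfacU L lam2 ψ₁ with hR₁
  set R₂ := RfacU L lam2 ψ₂ with hR₂
  -- step 1: split slot 1 at `p = 0`
  have h1 : (∑ p : Tor L, FfacU L lam2 ψ₁ p * F₂ (q - p)) = c₁ * F₂ q + ∑ p : Tor L, R₁ p * F₂ (q - p) := by
    have : ∀ p : Tor L, FfacU L lam2 ψ₁ p * F₂ (q - p)
        = c₁ * ((if p = 0 then (1 : ℂ) else 0) * F₂ (q - p)) + R₁ p * F₂ (q - p) := by
      intro p; rw [ffacU_split]; ring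
    simp_rw [this]
    rw [Finset.sum_add_distrib, ← Finset.mul_sum, sum_delta_zero L (fun p => F₂ (q - p))]
    simp only [sub_zero]
  -- step 2: split slot 2 at `p = q`
  have h2 : (∑ p : Tor L, R₁ p * F₂ (q - p)) = c₂ * R₁ q + ∑ p : Tor L, R₁ p * R₂ (q - p) := by
    have : ∀ p : Tor L, R₁ p * F₂ (q - p)
        = c₂ * ((if q - p = 0 then (1 : ℂ) else 0) * R₁ p) + R₁ p * R₂ (q - p) := by
      intro p; rw [hF₂, ffacU_split]; ring
    simp_rw [this]
    rw [Finset.sum_add_distrib, ← Finset.mul_sum, sum_delta_sub L q (fun p => R₁ p)]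
  rw [h1, h2, hF₂, ffacU_split L lam2 ψ₂ q]
  unfold closed2U
  simp only []
  rw [hc₁, hc₂, hR₁, hR₂]
  push_cast
  ring

/-- ★ `Z(F,G)(q) = closed2U + loop2U` when `F̂ = F_ψ₁`, `Ĝ = F_ψ₂`. [folklore] -/
theorem pairZ_split (lam2 : ℝ) {F G : Tor L → ℝ} {ψ₁ ψ₂ : Tor L × ℝ × ℝ × ℝ × ℝ × ℝ}
    (hF : dft L F = FfacU L lam2 ψ₁) (hG : dft L G = FfacU L lam2 ψ₂) (q : Tor L) :
    pairZ L F G q = closed2U L lam2 ψ₁ ψ₂ q + loop2U L lam2 ψ₁ ψ₂ q := by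
  have hV : ((L : ℂ) ^ 2) ≠ 0 := by
    have : (L : ℂ) ≠ 0 := by exact_mod_cast (NeZero.ne L)
    positivity
  rw [pairConvolution_holds L F G q, hF, hG, pair_numerator_split]
  unfold loop2U
  rw [add_div, mul_div_cancel_left₀ _ hV]

/-! ## Gradients and shifts of slots as uniform specs -/

section slots
variable (Δ lam2 : ℝ) (f : Tor L → ℝ)

/-- ★ `FT[D_e slot] = F_(psiU kind 1 (−1) e)` (ground profile, `L ≥ 5`, `0 ≤ Δ < 1`). -/
theorem dft_slotD (hL : 5 ≤ L) (hΔ0 : 0 ≤ Δ) (hΔ1 : Δ < 1) (hf : IsGroundTwoMagnon L Δ lam2 f) (kind : Bool) (e : Tor L) :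
    dft L (fun r => Dgrad L (slot L Δ f kind) e r) = FfacU L lam2 (psiU L Δ lam2 f kind 1 (-1) e) := by
  rw [← dft_slotW L Δ lam2 f hL hΔ0 hΔ1 hf kind e]
  funext q
  exact dgradTransform_holds L _ e q

omit [NeZero L] in
/-- the shifted spec: `e^{−iq·e}·F_(e′,1,0,α,β,γ)(q) = F_(e,0,1,α,β,γ)(q)`. -/
theorem ffacU_shift (lam2 α β γ : ℝ) (e e' q : Tor L) :
    (starRingEnd ℂ) (phase L q e) * FfacU L lam2 (e', 1, 0, α, β, γ) q = FfacU L lam2 (e, 0, 1, α, β, γ) q := by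
  unfold FfacU; push_cast; ring

/-- ★ `FT[slot(· − e)] = F_(psiU kind 0 1 e)`. -/
theorem dft_slot_shift_sub (hL : 5 ≤ L) (hΔ0 : 0 ≤ Δ) (hΔ1 : Δ < 1) (hf : IsGroundTwoMagnon L Δ lam2 f)
    (kind : Bool) (e : Tor L) :
    dft L (fun r => slot L Δ f kind (r - e)) = FfacU L lam2 (psiU L Δ lam2 f kind 0 1 e) := by
  funext q
  rw [(shiftTransform_holds L (slot L Δ f kind) e q).1, dft_slot0 L Δ lam2 f hL hΔ0 hΔ1 hf kind e]
  cases kind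
  · simp only [psiU, if_false, Bool.false_eq_true]; exact ffacU_shift L lam2 _ _ _ e e q
  · simp only [psiU, if_true]; exact ffacU_shift L lam2 _ _ _ e e q

/-- ★ `FT[slot(· + e)] = F_(psiU kind 0 1 (−e))`. -/
theorem dft_slot_shift_add (hL : 5 ≤ L) (hΔ0 : 0 ≤ Δ) (hΔ1 : Δ < 1) (hf : IsGroundTwoMagnon L Δ lam2 f)
    (kind : Bool) (e : Tor L) :
    dft L (fun r => slot L Δ f kind (r + e)) = FfacU L lam2 (psiU L Δ lam2 f kind 0 1 (-e)) := by
  have h : (fun r => slot L Δ f kind (r + e)) = fun r => slot L Δ f kind (r - -e) := by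
    funext r; rw [sub_neg_eq_add]
  rw [h]
  exact dft_slot_shift_sub L Δ lam2 f hL hΔ0 hΔ1 hf kind (-e)

/-! ## The six pair transforms of the boundary lines, split -/

/-- ★ `Z(slot k, D_e slot k′) = closed2U + loop2U` with specs `(psiU k 1 0 e, psiU k′ 1 (−1) e)`. -/
theorem pairZ_slot_D (hL : 5 ≤ L) (hΔ0 : 0 ≤ Δ) (hΔ1 : Δ < 1) (hf : IsGroundTwoMagnon L Δ lam2 f)
    (k k' : Bool) (e q : Tor L) :
    pairZ L (slot L Δ f k) (fun r => Dgrad L (slot L Δ f k') e r) q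
      = closed2U L lam2 (psiU L Δ lam2 f k 1 0 e) (psiU L Δ lam2 f k' 1 (-1) e) q
        + loop2U L lam2 (psiU L Δ lam2 f k 1 0 e) (psiU L Δ lam2 f k' 1 (-1) e) q :=
  pairZ_split L lam2 (dft_slot0 L Δ lam2 f hL hΔ0 hΔ1 hf k e) (dft_slotD L Δ lam2 f hL hΔ0 hΔ1 hf k' e) q

/-- ★ `Z(slot k (· − e), slot k′) = closed2U + loop2U` with specs `(psiU k 0 1 e, psiU k′ 1 0 e)`. -/
theorem pairZ_shift_slot (hL : 5 ≤ L) (hΔ0 : 0 ≤ Δ) (hΔ1 : Δ < 1) (hf : IsGroundTwoMagnon L Δ lam2 f)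
    (k k' : Bool) (e q : Tor L) :
    pairZ L (fun r => slot L Δ f k (r - e)) (slot L Δ f k') q
      = closed2U L lam2 (psiU L Δ lam2 f k 0 1 e) (psiU L Δ lam2 f k' 1 0 e) q
        + loop2U L lam2 (psiU L Δ lam2 f k 0 1 e) (psiU L Δ lam2 f k' 1 0 e) q :=
  pairZ_split L lam2 (dft_slot_shift_sub L Δ lam2 f hL hΔ0 hΔ1 hf k e) (dft_slot0 L Δ lam2 f hL hΔ0 hΔ1 hf k' e) q

/-- ★ `Z(slot k, slot k′ (· − e)) = closed2U + loop2U` with specs `(psiU k 1 0 e, psiU k′ 0 1 e)`. -/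
theorem pairZ_slot_shift (hL : 5 ≤ L) (hΔ0 : 0 ≤ Δ) (hΔ1 : Δ < 1) (hf : IsGroundTwoMagnon L Δ lam2 f)
    (k k' : Bool) (e q : Tor L) :
    pairZ L (slot L Δ f k) (fun r => slot L Δ f k' (r - e)) q
      = closed2U L lam2 (psiU L Δ lam2 f k 1 0 e) (psiU L Δ lam2 f k' 0 1 e) q
        + loop2U L lam2 (psiU L Δ lam2 f k 1 0 e) (psiU L Δ lam2 f k' 0 1 e) q :=
  pairZ_split L lam2 (dft_slot0 L Δ lam2 f hL hΔ0 hΔ1 hf k e) (dft_slot_shift_sub L Δ lam2 f hL hΔ0 hΔ1 hf k' e) q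

/-- ★ `Z(slot k (· + e), slot k′) = closed2U + loop2U` with specs `(psiU k 0 1 (−e), psiU k′ 1 0 e)`. -/
theorem pairZ_shiftp_slot (hL : 5 ≤ L) (hΔ0 : 0 ≤ Δ) (hΔ1 : Δ < 1) (hf : IsGroundTwoMagnon L Δ lam2 f)
    (k k' : Bool) (e q : Tor L) :
    pairZ L (fun r => slot L Δ f k (r + e)) (slot L Δ f k') q
      = closed2U L lam2 (psiU L Δ lam2 f k 0 1 (-e)) (psiU L Δ lam2 f k' 1 0 e) q
        + loop2U L lam2 (psiU L Δ lam2 f k 0 1 (-e)) (psiU L Δ lam2 f k' 1 0 e) q :=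
  pairZ_split L lam2 (dft_slot_shift_add L Δ lam2 f hL hΔ0 hΔ1 hf k e) (dft_slot0 L Δ lam2 f hL hΔ0 hΔ1 hf k' e) q

/-- ★ `Z(slot k, slot k′ (· + e)) = closed2U + loop2U` with specs `(psiU k 1 0 e, psiU k′ 0 1 (−e))`. -/
theorem pairZ_slot_shiftp (hL : 5 ≤ L) (hΔ0 : 0 ≤ Δ) (hΔ1 : Δ < 1) (hf : IsGroundTwoMagnon L Δ lam2 f)
    (k k' : Bool) (e q : Tor L) :
    pairZ L (slot L Δ f k) (fun r => slot L Δ f k' (r + e)) q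
      = closed2U L lam2 (psiU L Δ lam2 f k 1 0 e) (psiU L Δ lam2 f k' 0 1 (-e)) q
        + loop2U L lam2 (psiU L Δ lam2 f k 1 0 e) (psiU L Δ lam2 f k' 0 1 (-e)) q :=
  pairZ_split L lam2 (dft_slot0 L Δ lam2 f hL hΔ0 hΔ1 hf k e) (dft_slot_shift_add L Δ lam2 f hL hΔ0 hΔ1 hf k' e) q

end slots

end RowD

end Summit.HubbardSuperconductivity.HubbardSuperconductivity.Theorems.AnisotropyChord.Transfer.Fibre3
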